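import Summits.ResolutionOfSingularities.ResolutionOfSingularities.Theorems.WeightedInvariantIota3JSigmaDominanceUpgrade
import Summits.ResolutionOfSingularities.ResolutionOfSingularities.Theorems.WeightedInvariantIota3TwoFlagCompletion
import HarnessLib

/-!
# (o70-b) PART 2d — NORMAL FORM OF A NON-DOMINANT SECOND MEMBER (`in_W(g₂') = λ·X^m`, `qm < r₂`)
# (door `HypersurfaceCentreConstruction`, stmt-ResolutionOfSingularities-19897; clause h8 ⟸ (σ-pres)₃ ⟸ (o70-a) + (o70-b) + (o70-x);
# SPEC (Δ12) rev 2 `L/res-L1-w43-plan-1/JSigmaCanon_sketch.lean` aceffaa8e08fb006 of res-L1-w43-plan-1; hand res-D-brk-1)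

Topic: `Summits/ResolutionOfSingularities/ResolutionOfSingularities/Theorems`. Helper for the door item
`HypersurfaceCentreConstruction` (stmt-ResolutionOfSingularities-19897, route `WeightedInvariant`), line `local-engine`
(L W4.3), def-free.  After PARTS 1, 2a–2c (p564416, p565670, p567051, p567666) the residue of (J-can) is the membership
`g₂' ∈ F(r₂)` of the second member of one σ-maximiser in the other's filtration (`q < r₂ < r₁`).  This file is the ENTRY POINT of
every attack on that residue (memo `D/res-D-brk-1/O70B-JCAN-PLAN.md` §1 (θ), (H), (T)): the shape of a second member that FAILS it.

* `flagContactFiltration_le_span_pow_sup_succ_of_lt` — below the second weight the filtration is carried by the transversal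
  parameter alone: for `𝔪 = (x, g₂, g₁)` and `k < r₂`, `F(k) ≤ (x^⌈k/q⌉) ⊔ F(k+1)`;
* `exists_unit_mul_pow_of_not_mem_weight₂` — **normal form**: `h ∈ 𝔪 ∖ F(r₂)` ⇒ `h = s·x^m + t` with `s` a unit, `1 ≤ m`,
  `q·m < r₂`, `t ∈ F(qm+1)`, `h ∉ F(qm+1)` (so `in_W(h) = s̄·X^m`: the W-initial form of a non-dominant member is a pure power
  of the transversal parameter);
* `IsTwoFlag.exists_unit_mul_pow_of_not_mem_weight₂` — the same for a two-flag of a regular local ring of dimension `3`, the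
  completing `x` supplied by (o70-x) `exists_span_triple_of_isTwoFlag` (res-D-pv-048).

[OURS · L1 W4.3 · (o70-b) PART 2d]  Replaces the role of NO printed item; NOT a statement of the manuscript
[claim: Hironaka2017, status: under-review]. AI work, weaker than expert review.  No named facts.
-/

noncomputable section

set_option linter.dupNamespace false -- mandated namespace `Summit.<Summit>.<Problem>` of this single-conjunct summit

open IsLocalRing Literature.AlgebraicGeometry.Resolution
open Summit.ResolutionOfSingularities.ResolutionOfSingularities.Theorems

namespace Summit.ResolutionOfSingularities.ResolutionOfSingularities.Cruxes.HypersurfaceCentreConstruction.LocalEngine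

namespace Iota3

universe u

section LocalRing

variable {S : Type u} [CommRing S] [IsLocalRing S]

/-- **Below the second weight only the transversal parameter counts**: for `𝔪 = (x, g₂, g₁)`, weights `0 < q ≤ r₂ ≤ r₁` and a
level `k < r₂`, `F_{(g₁,g₂)}(k) ≤ (x^⌈k/q⌉) ⊔ F_{(g₁,g₂)}(k+1)` (a monomial `x^c g₂^b g₁^a` of weight `≥ k` either is a pure power
`x^c`, `qc ≥ k`, or involves `g₂`/`g₁` and then weighs `≥ r₂ ≥ k + 1`). [folklore] -/
theorem flagContactFiltration_le_span_pow_sup_succ_of_lt {x g₁ g₂ : S} {q r₁ r₂ : ℕ}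
    (h𝔪 : Ideal.span {x, g₂, g₁} = maximalIdeal S) (hq : 0 < q) (hq₂ : q ≤ r₂) (h₂₁ : r₂ ≤ r₁) {k : ℕ} (hk : k < r₂) :
    flagContactFiltration g₁ g₂ q r₁ r₂ k ≤
      Ideal.span {x ^ ((k + q - 1) / q)} ⊔ flagContactFiltration g₁ g₂ q r₁ r₂ (k + 1) := by
  have hq₁ : q ≤ r₁ := hq₂.trans h₂₁
  rw [flagContactFiltration_eq_weightedMonomialIdeal h𝔪 hq hq₂ hq₁ k,
    flagContactFiltration_eq_weightedMonomialIdeal h𝔪 hq hq₂ hq₁ (k + 1)]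
  unfold weightedMonomialIdeal
  refine Ideal.span_le.mpr ?_
  rintro _ ⟨α, hα, rfl⟩
  simp only [Fin.sum_univ_three, Matrix.cons_val_zero, Matrix.cons_val_one, Matrix.cons_val_two, Matrix.head_cons,
    Matrix.tail_cons] at hα
  rw [SetLike.mem_coe, prod_vec₃_pow]
  by_cases h0 : α 1 = 0 ∧ α 2 = 0
  · obtain ⟨h1, h2⟩ := h0
    rw [h1, h2, pow_zero, pow_zero, mul_one, mul_one]
    refine Ideal.mem_sup_left (Ideal.mem_span_singleton.mpr (pow_dvd_pow x ?_))
    rw [h1, h2, mul_zero, mul_zero, add_zero, add_zero] at hα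
    exact AQSHeightTwo.cdiv_le_of_le_mul hq hα
  · refine Ideal.mem_sup_right (Ideal.subset_span ⟨α, ?_, (prod_vec₃_pow x g₂ g₁ α).symm⟩)
    simp only [Fin.sum_univ_three, Matrix.cons_val_zero, Matrix.cons_val_one, Matrix.cons_val_two, Matrix.head_cons,
      Matrix.tail_cons]
    rcases not_and_or.mp h0 with h1 | h2
    · have : r₂ ≤ r₂ * α 1 := Nat.le_mul_of_pos_right r₂ (Nat.pos_of_ne_zero h1)
      omega
    · have : r₁ ≤ r₁ * α 2 := Nat.le_mul_of_pos_right r₁ (Nat.pos_of_ne_zero h2)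
      omega

/-- **NORMAL FORM OF A NON-DOMINANT MEMBER.**  For `𝔪 = (x, g₂, g₁)`, weights `0 < q ≤ r₂ ≤ r₁`: an element `h ∈ 𝔪` OUTSIDE the
second weight level `F(r₂)` is `h = s·x^m + t` with `s` a unit, `1 ≤ m`, `q·m < r₂`, `t ∈ F(qm+1)` — and `h ∈ F(qm) ∖ F(qm+1)` (its
weighted initial form is the pure power `s̄·X^m`). [OURS · L1 W4.3 · (o70-b)] -/
theorem exists_unit_mul_pow_of_not_mem_weight₂ {x g₁ g₂ : S} {q r₁ r₂ : ℕ}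
    (h𝔪 : Ideal.span {x, g₂, g₁} = maximalIdeal S) (hq : 0 < q) (hq₂ : q ≤ r₂) (h₂₁ : r₂ ≤ r₁) {h : S}
    (hh : h ∈ maximalIdeal S) (hnot : h ∉ flagContactFiltration g₁ g₂ q r₁ r₂ r₂) :
    ∃ (m : ℕ) (s t : S), IsUnit s ∧ 1 ≤ m ∧ q * m < r₂ ∧ h = s * x ^ m + t ∧
      t ∈ flagContactFiltration g₁ g₂ q r₁ r₂ (q * m + 1) ∧ h ∈ flagContactFiltration g₁ g₂ q r₁ r₂ (q * m) ∧
      h ∉ flagContactFiltration g₁ g₂ q r₁ r₂ (q * m + 1) := by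
  classical
  set P : ℕ → Prop := fun n => h ∈ flagContactFiltration g₁ g₂ q r₁ r₂ n with hP
  set k := Nat.findGreatest P r₂ with hkdef
  have hPq : P q := maximalIdeal_le_flagContactFiltration g₁ g₂ r₁ r₂ hq hh
  have hPk : h ∈ flagContactFiltration g₁ g₂ q r₁ r₂ k := Nat.findGreatest_spec (P := P) hq₂ hPq
  have hqk : q ≤ k := Nat.le_findGreatest hq₂ hPq
  have hkr : k ≤ r₂ := Nat.findGreatest_le r₂
  have hkne : k ≠ r₂ := fun e => hnot (by rw [e] at hPk; exact hPk)
  have hk : k < r₂ := lt_of_le_of_ne hkr hkne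
  have hnotk : h ∉ flagContactFiltration g₁ g₂ q r₁ r₂ (k + 1) :=
    Nat.findGreatest_is_greatest (P := P) (Nat.lt_succ_self k) hk
  -- `h = s · x^m + t`
  set m := (k + q - 1) / q with hmdef
  obtain ⟨sx, hsx, t, ht, hsum⟩ :=
    Submodule.mem_sup.mp (flagContactFiltration_le_span_pow_sup_succ_of_lt h𝔪 hq hq₂ h₂₁ hk hPk)
  obtain ⟨s, rfl⟩ := Ideal.mem_span_singleton'.mp hsx
  have hx : x ∈ maximalIdeal S := h𝔪 ▸ Ideal.subset_span (by simp)
  have hxF : x ∈ flagContactFiltration g₁ g₂ q r₁ r₂ q := maximalIdeal_le_flagContactFiltration g₁ g₂ r₁ r₂ hq hx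
  have hxm : x ^ m ∈ flagContactFiltration g₁ g₂ q r₁ r₂ (q * m) :=
    pow_le_flagContactFiltration_mul g₁ g₂ r₁ r₂ hq q m (Ideal.pow_mem_pow hxF m)
  have hkm : k ≤ q * m := by simpa [hmdef] using le_add_mul_cdiv hq k 0
  -- `q · m = k`: otherwise `s x^m ∈ F(k+1)` and `h ∈ F(k+1)`
  have hqm : q * m = k := by
    by_contra hne
    have hlt : k + 1 ≤ q * m := by omega
    refine hnotk ?_
    rw [← hsum]
    exact Ideal.add_mem _ (Ideal.mul_mem_left _ s (flagContactFiltration_antitone g₁ g₂ q r₁ r₂ hlt hxm)) ht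
  -- `s` is a unit: otherwise `s x^m ∈ F(q + qm) ≤ F(k+1)`
  have hs : IsUnit s := by
    by_contra hsu
    have hsm : s ∈ flagContactFiltration g₁ g₂ q r₁ r₂ q :=
      maximalIdeal_le_flagContactFiltration g₁ g₂ r₁ r₂ hq ((IsLocalRing.mem_maximalIdeal s).mpr hsu)
    refine hnotk ?_
    rw [← hsum]
    refine Ideal.add_mem _ ?_ ht
    refine flagContactFiltration_antitone g₁ g₂ q r₁ r₂ (show k + 1 ≤ q + q * m by omega) ?_
    exact flagContactFiltration_mul_le g₁ g₂ q r₁ r₂ hq _ _ (Ideal.mul_mem_mul hsm hxm)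
  have hm1 : 1 ≤ m := by
    refine Nat.pos_of_ne_zero fun h0 => ?_
    rw [h0, mul_zero] at hqm
    omega
  rw [← hqm] at ht hPk hnotk
  exact ⟨m, s, t, hs, hm1, hqm.trans_lt hk, hsum.symm, ht, hPk, hnotk⟩

end LocalRing

/-! ## The two-flag wording in dimension three -/

section Regular

variable {S : Type} [CommRing S] [IsRegularLocalRing S]

/-- **Normal form of a non-dominant second member, two-flags of a regular local ring of dimension `3`**: if `(g₁, g₂)` is a
two-flag, `(q; r₁, r₂)` admissible, and `h ∈ 𝔪` is NOT in `F_{(g₁,g₂)}(r₂)`, then for a completing parameter `x` (`𝔪 = (x, g₂, g₁)`,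
(o70-x)) `h = s·x^m + t`, `s` a unit, `1 ≤ m`, `qm < r₂`, `t ∈ F(qm+1)`, `h ∈ F(qm) ∖ F(qm+1)`.  Applied to the second member `g₂'`
of another σ-maximiser this is the starting point of the residue of (J-can). [OURS · L1 W4.3 · (o70-b)] -/
theorem IsTwoFlag.exists_unit_mul_pow_of_not_mem_weight₂ (hdim : ringKrullDim S = (3 : ℕ)) {g₁ g₂ : S}
    (hΦ : IsTwoFlag g₁ g₂) {q r₁ r₂ : ℕ} (hadm : AdmissibleTriple q r₁ r₂) {h : S} (hh : h ∈ maximalIdeal S)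
    (hnot : h ∉ flagContactFiltration g₁ g₂ q r₁ r₂ r₂) :
    ∃ (x : S) (m : ℕ) (s t : S), Ideal.span {x, g₂, g₁} = maximalIdeal S ∧ IsUnit s ∧ 1 ≤ m ∧ q * m < r₂ ∧
      h = s * x ^ m + t ∧ t ∈ flagContactFiltration g₁ g₂ q r₁ r₂ (q * m + 1) ∧
      h ∈ flagContactFiltration g₁ g₂ q r₁ r₂ (q * m) ∧ h ∉ flagContactFiltration g₁ g₂ q r₁ r₂ (q * m + 1) := by
  obtain ⟨x, hx, -⟩ := exists_span_triple_of_isTwoFlag S hdim g₁ g₂ hΦ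
  obtain ⟨m, s, t, hs, hm, hqm, hsum, ht, hmem, hnmem⟩ :=
    _root_.Summit.ResolutionOfSingularities.ResolutionOfSingularities.Cruxes.HypersurfaceCentreConstruction.LocalEngine.Iota3.exists_unit_mul_pow_of_not_mem_weight₂
      hx hadm.1 hadm.2.1 hadm.2.2 hh hnot
  exact ⟨x, m, s, t, hx, hs, hm, hqm, hsum, ht, hmem, hnmem⟩

end Regular

end Iota3

end Summit.ResolutionOfSingularities.ResolutionOfSingularities.Cruxes.HypersurfaceCentreConstruction.LocalEngine

end
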